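import Mathlib

/-!
# B3AdelicSurjectivity — surjectivity on restricted products from local surjectivity plus
the unit refinement at almost all places (T4-B3 §B2(d)(ii)–(iii), the adèlic step)

T4-B3 §B2(d) (route/T4-B3-p2.md l. 25) passes from the local statements «`y_v = e_v / c(e_v)`
(Hilbert 90) and, at the unramified places where `y_v` is a unit, `e_v` can be taken a unit»
to the adèlic one «an element `y ∈ E^1(𝔸)` is `j(e)` with `e = (e_v)_v ∈ 𝔸_E^×` (`e_v` a unit
for almost all `v`)». `B3Hilbert90.lean` and `B3UnitRefinement.lean` hold the two local
statements; this file holds the bookkeeping that assembles them into the adèlic one.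

Model: a family of maps `j v : A v → B v` indexed by the places `v`, with «unit» subsets
`U v ⊆ A v`, `V v ⊆ B v`; the restricted product of the `A v` with respect to the `U v` is the
set of `a : ∀ v, A v` with `a v ∈ U v` for all but finitely many `v` (`Filter.cofinite`).

* **`exists_preimage_eventuallyMem`** — if every `j v` is surjective and, for almost all `v`,
  every element of `V v` has a preimage in `U v`, then every `y` with `y v ∈ V v` for almost all
  `v` is `j(a)` for some `a` with `a v ∈ U v` for almost all `v`;
* `restrictedProd` (the set) and `restrictedProdSubgroup` (the subgroup, for groups and
  subgroups), `map_restrictedProd_surjective` — the same as surjectivity of the induced map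
  between restricted products;
* `mem_restrictedProdSubgroup_of_forall` — elements with `a v ∈ U v` for ALL `v` lie in it.

Nothing about idèles, places or the norm-one torus is formalised: `ι` is any index type.
-/

namespace Summit.Ventures.HodgeRepro2.ShimuraData.B3AdelicSurjectivity

open Filter

variable {ι : Type*} {A B : ι → Type*}

/-- **Surjectivity on restricted products.** If every `j v` is surjective and for almost all `v`
every element of `V v` lifts to `U v`, then every `y` with `y v ∈ V v` for almost all `v` lifts
to an `a` with `a v ∈ U v` for almost all `v`. -/
theorem exists_preimage_eventuallyMem (j : ∀ v, A v → B v) (U : ∀ v, Set (A v))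
    (V : ∀ v, Set (B v)) (hsurj : ∀ v, Function.Surjective (j v))
    (hunit : ∀ᶠ v in cofinite, ∀ y ∈ V v, ∃ a ∈ U v, j v a = y) (y : ∀ v, B v)
    (hy : ∀ᶠ v in cofinite, y v ∈ V v) :
    ∃ a : ∀ v, A v, (∀ v, j v (a v) = y v) ∧ ∀ᶠ v in cofinite, a v ∈ U v := by
  classical
  have key : ∀ v, ∃ a : A v, j v a = y v ∧
      ((y v ∈ V v ∧ ∀ y' ∈ V v, ∃ a' ∈ U v, j v a' = y') → a ∈ U v) := by
    intro v
    by_cases h : y v ∈ V v ∧ ∀ y' ∈ V v, ∃ a' ∈ U v, j v a' = y'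
    · obtain ⟨a, ha, hja⟩ := h.2 (y v) h.1
      exact ⟨a, hja, fun _ => ha⟩
    · obtain ⟨a, hja⟩ := hsurj v (y v)
      exact ⟨a, hja, fun h' => absurd h' h⟩
  choose a ha using key
  refine ⟨a, fun v => (ha v).1, ?_⟩
  filter_upwards [hy, hunit] with v hv hu
  exact (ha v).2 ⟨hv, hu⟩

/-- The restricted product of the sets `A v` with respect to the subsets `U v`, as a set. -/
def restrictedProd (U : ∀ v, Set (A v)) : Set (∀ v, A v) :=
  {a | ∀ᶠ v in cofinite, a v ∈ U v}

/-- Membership in the restricted product. -/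
theorem mem_restrictedProd {U : ∀ v, Set (A v)} {a : ∀ v, A v} :
    a ∈ restrictedProd U ↔ ∀ᶠ v in cofinite, a v ∈ U v := Iff.rfl

/-- The map `y ↦ j(a)` between restricted products is surjective under the hypotheses of
`exists_preimage_eventuallyMem`. -/
theorem map_restrictedProd_surjective (j : ∀ v, A v → B v) (U : ∀ v, Set (A v))
    (V : ∀ v, Set (B v)) (hsurj : ∀ v, Function.Surjective (j v))
    (hunit : ∀ᶠ v in cofinite, ∀ y ∈ V v, ∃ a ∈ U v, j v a = y) :
    ∀ y ∈ restrictedProd V, ∃ a ∈ restrictedProd U, (fun v => j v (a v)) = y := by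
  intro y hy
  obtain ⟨a, hja, ha⟩ := exists_preimage_eventuallyMem j U V hsurj hunit y hy
  exact ⟨a, ha, funext hja⟩

section Groups

variable {G : ι → Type*} [∀ v, Group (G v)]

/-- The restricted product of groups with respect to subgroups is a subgroup of the product. -/
def restrictedProdSubgroup (U : ∀ v, Subgroup (G v)) : Subgroup (∀ v, G v) where
  carrier := restrictedProd fun v => (U v : Set (G v))
  one_mem' := by
    simp only [restrictedProd, Set.mem_setOf_eq, Pi.one_apply, SetLike.mem_coe, one_mem]
    exact Filter.Eventually.of_forall fun _ => trivial
  mul_mem' := by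
    intro a b ha hb
    simp only [restrictedProd, Set.mem_setOf_eq, SetLike.mem_coe] at ha hb ⊢
    filter_upwards [ha, hb] with v hav hbv
    exact mul_mem hav hbv
  inv_mem' := by
    intro a ha
    simp only [restrictedProd, Set.mem_setOf_eq, SetLike.mem_coe] at ha ⊢
    filter_upwards [ha] with v hav
    exact inv_mem hav

/-- Membership in the restricted product subgroup. -/
theorem mem_restrictedProdSubgroup {U : ∀ v, Subgroup (G v)} {a : ∀ v, G v} :
    a ∈ restrictedProdSubgroup U ↔ ∀ᶠ v in cofinite, a v ∈ U v := Iff.rfl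

/-- An element with `a v ∈ U v` for every `v` lies in the restricted product. -/
theorem mem_restrictedProdSubgroup_of_forall {U : ∀ v, Subgroup (G v)} {a : ∀ v, G v}
    (h : ∀ v, a v ∈ U v) : a ∈ restrictedProdSubgroup U :=
  mem_restrictedProdSubgroup.mpr (Filter.Eventually.of_forall h)

/-- **The adèlic surjectivity of `j`.** For families of group homomorphisms `j v : G v →* H v`
that are surjective, with «unit» subgroups `U v`, `V v` such that for almost all `v` every element
of `V v` lifts to `U v`: the induced map of restricted products is surjective. -/
theorem restrictedProdSubgroup_map_surjective {H : ι → Type*} [∀ v, Group (H v)]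
    (j : ∀ v, G v →* H v) (U : ∀ v, Subgroup (G v)) (V : ∀ v, Subgroup (H v))
    (hsurj : ∀ v, Function.Surjective (j v))
    (hunit : ∀ᶠ v in cofinite, ∀ y ∈ V v, ∃ a ∈ U v, j v a = y) :
    ∀ y ∈ restrictedProdSubgroup V, ∃ a ∈ restrictedProdSubgroup U, (fun v => j v (a v)) = y :=
  map_restrictedProd_surjective (fun v => (j v : G v → H v)) (fun v => (U v : Set (G v)))
    (fun v => (V v : Set (H v))) hsurj hunit

end Groups

end Summit.Ventures.HodgeRepro2.ShimuraData.B3AdelicSurjectivity
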